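/-
Copyright (c) 2026 the pub-hodgecm-mathlib formalisation cell (harness21).  Prover seat hodgecm-mathlib-K2Liu-p14 (g0): Track B «K2-LIT»,
hLiu418 = stmt-HodgeConjecture-24832; LEAD F0P6-plan (g13) RULING M-157b 2026-09-04T08:37:16Z «G5 (β) GODEMENT SECTIONS EXHAUST», file (β1), part 2.
-/
import Summits.HodgeConjecture.HodgeConjecture.Theorems.K2LiuGL2GodementSectionOfFlatFinite   -- (β1) part 1: primitive vectors, the Schwartz function `Φ`
import HarnessLib

/-!
# Crux `HLiu418`, road `K2_Liu`, Road Φ organ G5 (β) «Godement sections exhaust the flat sections», file (β1) part 2: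
# THE LOCAL GODEMENT COEFFICIENT OF THE PRIMITIVE-SHELL FUNCTION IS THE CONSTANT `μ'(𝒪ˣ)`

Cell `hodgecm-mathlib`, crux item hLiu418 = `stmt-HodgeConjecture-24832`; squad K2 ∕ K2Liu; prover K2Liu-p14 (g0).
THEOREMS ONLY (no `def`, no instance, no notation, no named-fact hypothesis, no `sorry`); lane `--supports stmt-HodgeConjecture-24832`
(count-neutral helper).  Continuation of ★ `K2LiuGL2GodementSectionOfFlatFinite` (part 1: `Φ ∈ 𝒮(F²)` supported on the primitive vectors with
`Φ(e₂ k) = F₀(k)` on `K = GL₂(𝒪)`), split at the 400-line rule.  Same hypotheses BY VALUE on the pair `(Φ, F₀)`: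
`hΦ0` (vanishing off the primitive vectors), `hΦF` (`Φ(e₂ k) = F₀ k`), `hB` (`F₀` left-`B(𝒪)`-invariant on `K`).
* §3 for every `k ∈ K` and EVERY `z ∈ ℂ`:  **`∫_{Fˣ} Φ(a · e₂k) |a|^z dμ'(a) = μ'(𝒪ˣ) · F₀(k)`** (integrand `= F₀(k)·𝟙_{𝒪ˣ}`: on the unit shell
  `a e₂ k = e₂ diag(1,a) k` and `F₀(diag(1,a) k) = F₀ k`; off it `a e₂ k` is not primitive) — the local Godement coefficient is CONSTANT in `s`;
  ★ `tateZeta` spelling `Z(Φ(· e₂ k), 1, z) = μ'(𝒪ˣ) F₀(k)`.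
* §4 on `GL₂(F) = B · K` (★ `exists_borel_mul_glInt`): for `g = b k`, `e₂ g = b₁₁ · e₂ k` and the substitution `a ↦ a b₁₁⁻¹` (right-invariant `μ'`) give
  **`|det g|^s · ∫ Φ(a e₂ g)|a|^{2s} dμ' = μ'(𝒪ˣ) · |b₀₀|^s |b₁₁|^{−s} · F₀(k)`** — the Godement section `f_Φ(·, s)` is `μ'(𝒪ˣ)` times the flat section
  through `F₀` of `Ind(|·|^s, |·|^{−s})`, for every `s`.  File (β4) tensors these into `piSchwartzBruhat` against ★ `mirabolicEisenstein`.
HONEST LABEL.  `HC_CM` is proved only modulo the 7 printed citations (2 remaining named inputs: hLiu418 = `stmt-HodgeConjecture-24832`,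
h413 = `stmt-HodgeConjecture-24833`) until rung 0 closes.

## References
* [Bump1997] D. Bump, *Automorphic Forms and Representations* (1997), §3.7 (Godement sections), Prop. 4.5.2 (Iwasawa decomposition).
* [CogdellAnalyticTheory2004] J. W. Cogdell, *Analytic theory of L-functions for GL_n*, §2.3 (`F(g, Φ; s) = |det g|^s ∫ Φ(a e_n g)|a|^{ns} d^×a`).
* [JacquetLanglands1970] H. Jacquet, R. P. Langlands, *Automorphic forms on GL(2)*, LNM 114 (1970), §3.
* [Tate1950] J. Tate, *Fourier analysis in number fields and Hecke's zeta-functions* (1950), §2.4–2.5.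
-/

set_option autoImplicit false
set_option linter.dupNamespace false -- the mandated namespace repeats `HodgeConjecture.HodgeConjecture`

noncomputable section

open MeasureTheory ValuativeRel
open scoped NNReal MatrixGroups Topology Matrix
open Literature.NumberTheory.GaloisRepresentations Literature.NumberTheory.GaloisRepresentations.IsNonarchimedeanLocalField
open Literature.NumberTheory.Automorphic
open Summit.HodgeConjecture.HodgeConjecture.Cruxes.HLiu418.K2LiuGL2GodementSectionOfFlatFinite

namespace Summit.HodgeConjecture.HodgeConjecture.Cruxes.HLiu418.K2LiuGL2GodementCoefficientFinite

/-! ## §3 The local Godement coefficient is the CONSTANT `μ'(𝒪ˣ)` -/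

section Coefficient

variable {F : Type*} [Field F] [ValuativeRel F] [TopologicalSpace F] [IsNonarchimedeanLocalField F]
  [MeasurableSpace F] [BorelSpace F]

/-- **`∫_{Fˣ} Φ(a · e₂k) |a|^z dμ'(a) = μ'(𝒪ˣ) · F₀(k)` for every `k ∈ K` and EVERY `z ∈ ℂ`** — the integrand is `F₀(k) · 𝟙_{𝒪ˣ}`:
on the unit shell `a e₂ k = e₂ diag(1,a) k` and `F₀(diag(1,a) k) = F₀ k`; off it `a e₂ k` is not primitive and `Φ` vanishes.  (`μ'` any measure on
`Fˣ` finite on compacts.) [cite: Bump1997, §3.7] [cite: Tate1950, §2.5] [cite: CogdellAnalyticTheory2004, §2.3] -/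
theorem integrable_and_integral_eq_const (μ' : Measure Fˣ) [IsFiniteMeasureOnCompacts μ'] {Φ : (Fin 2 → F) → ℂ} {F₀ : GL (Fin 2) F → ℂ}
    (hΦ0 : ∀ x : Fin 2 → F, ¬ ((∀ j, valuation F (x j) ≤ 1) ∧ ∃ j, valuation F (x j) = 1) → Φ x = 0)
    (hΦF : ∀ k ∈ glInt 2 F, Φ ((k : Matrix (Fin 2) (Fin 2) F) 1) = F₀ k)
    (hB : ∀ p ∈ glInt 2 F, (p : Matrix (Fin 2) (Fin 2) F) 1 0 = 0 → ∀ k ∈ glInt 2 F, F₀ (p * k) = F₀ k)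
    {k : GL (Fin 2) F} (hk : k ∈ glInt 2 F) (z : ℂ) :
    Integrable (fun a : Fˣ => Φ ((a : F) • ((Pi.single 1 1 : Fin 2 → F) ᵥ* (k : Matrix (Fin 2) (Fin 2) F))) *
        (((normAbs F (a : F) : ℝ≥0) : ℝ) : ℂ) ^ z) μ' ∧
      ∫ a : Fˣ, Φ ((a : F) • ((Pi.single 1 1 : Fin 2 → F) ᵥ* (k : Matrix (Fin 2) (Fin 2) F))) *
          (((normAbs F (a : F) : ℝ≥0) : ℝ) : ℂ) ^ z ∂μ' = μ'.real {a : Fˣ | valuation F (a : F) = 1} * F₀ k := by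
  haveI : BorelSpace Fˣ := Units.borelSpace
  set U : Set Fˣ := {a : Fˣ | valuation F (a : F) = 1} with hUdef
  have hUm : MeasurableSet U := isOpen_units_valuation_eq_one.measurableSet
  have hUfin : μ' U < ⊤ := isCompact_units_valuation_eq_one.measure_lt_top
  -- the integrand is `F₀ k · 𝟙_U`
  have hint : ∀ a : Fˣ, Φ ((a : F) • ((Pi.single 1 1 : Fin 2 → F) ᵥ* (k : Matrix (Fin 2) (Fin 2) F))) *
      (((normAbs F (a : F) : ℝ≥0) : ℝ) : ℂ) ^ z = U.indicator (fun _ => F₀ k) a := by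
    intro a
    rw [single_one_vecMul_eq]
    by_cases ha : a ∈ U
    · have ha1 : valuation F (a : F) = 1 := ha
      rw [Set.indicator_of_mem ha, smul_apply_one_eq_diagonalGL_mul,
        hΦF _ (Subgroup.mul_mem _ (diagonalGL_one_mem_glInt ha1) hk),
        hB _ (diagonalGL_one_mem_glInt ha1) (diagonalGL_one_apply_one_zero a) k hk,
        DeltaCharBorel.normAbs_eq_one_of_valuation_eq_one ha1, NNReal.coe_one, Complex.ofReal_one, Complex.one_cpow, mul_one]
    · rw [Set.indicator_of_notMem ha, hΦ0 _ (fun h => ha ((prim_smul_apply_one_iff hk a).1 h)), zero_mul]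
  have hfun : (fun a : Fˣ => Φ ((a : F) • ((Pi.single 1 1 : Fin 2 → F) ᵥ* (k : Matrix (Fin 2) (Fin 2) F))) *
      (((normAbs F (a : F) : ℝ≥0) : ℝ) : ℂ) ^ z) = U.indicator (fun _ => F₀ k) := funext hint
  rw [hfun]
  refine ⟨(integrable_indicator_iff hUm).2 (integrableOn_const hUfin.ne), ?_⟩
  rw [integral_indicator_const _ hUm, Complex.real_smul, Measure.real]

/-- … the same in ★ `tateZeta` spelling: `Z(Φ(· e₂ k), 1, z) = μ'(𝒪ˣ) · F₀(k)`. [cite: Tate1950, §2.4] [cite: Bump1997, §3.7] -/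
theorem tateZeta_smul_apply_one_eq_const (μ' : Measure Fˣ) [IsFiniteMeasureOnCompacts μ'] {Φ : (Fin 2 → F) → ℂ} {F₀ : GL (Fin 2) F → ℂ}
    (hΦ0 : ∀ x : Fin 2 → F, ¬ ((∀ j, valuation F (x j) ≤ 1) ∧ ∃ j, valuation F (x j) = 1) → Φ x = 0)
    (hΦF : ∀ k ∈ glInt 2 F, Φ ((k : Matrix (Fin 2) (Fin 2) F) 1) = F₀ k)
    (hB : ∀ p ∈ glInt 2 F, (p : Matrix (Fin 2) (Fin 2) F) 1 0 = 0 → ∀ k ∈ glInt 2 F, F₀ (p * k) = F₀ k)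
    {k : GL (Fin 2) F} (hk : k ∈ glInt 2 F) (z : ℂ) :
    tateZeta μ' (fun t : F => Φ (t • ((Pi.single 1 1 : Fin 2 → F) ᵥ* (k : Matrix (Fin 2) (Fin 2) F)))) 1 z =
      μ'.real {a : Fˣ | valuation F (a : F) = 1} * F₀ k := by
  rw [tateZeta, ← (integrable_and_integral_eq_const μ' hΦ0 hΦF hB hk z).2]
  refine integral_congr_ae (Filter.Eventually.of_forall fun a => ?_)
  simp

end Coefficient

/-! ## §4 On `GL₂(F) = B · K`: the Godement section is `μ'(𝒪ˣ)` times the flat section through `F₀` -/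

section Section

variable {F : Type*} [Field F] [ValuativeRel F] [TopologicalSpace F] [IsNonarchimedeanLocalField F]
  [MeasurableSpace F] [BorelSpace F]

omit [ValuativeRel F] [TopologicalSpace F] [IsNonarchimedeanLocalField F] [MeasurableSpace F] [BorelSpace F] in
/-- `e₂ (b k) = b₁₁ · (e₂ k)` for `b` upper triangular. [cite: Bump1997, §3.7] -/
theorem single_one_vecMul_borel_mul {b k : GL (Fin 2) F} (hb : (b : Matrix (Fin 2) (Fin 2) F) 1 0 = 0) :
    (Pi.single 1 1 : Fin 2 → F) ᵥ* ((b * k : GL (Fin 2) F) : Matrix (Fin 2) (Fin 2) F) =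
      (b : Matrix (Fin 2) (Fin 2) F) 1 1 • ((Pi.single 1 1 : Fin 2 → F) ᵥ* (k : Matrix (Fin 2) (Fin 2) F)) := by
  rw [Units.val_mul, ← Matrix.vecMul_vecMul, single_one_vecMul_eq, single_one_vecMul_eq]
  ext j
  rw [Matrix.vecMul, dotProduct, Fin.sum_univ_two, hb, zero_mul, zero_add, Pi.smul_apply, smul_eq_mul]

/-- **THE GODEMENT INTEGRAL OF `Φ` ON `GL₂(F)`**: for `g = b k` (`b` upper triangular, `k ∈ K`), a right-invariant `μ'` and every `z`,
`∫ Φ(a · e₂ g) |a|^z dμ'(a) = |b₁₁|^{−z} · μ'(𝒪ˣ) · F₀(k)` (substitute `a ↦ a b₁₁⁻¹`). [cite: Bump1997, §3.7] [cite: CogdellAnalyticTheory2004, §2.3] -/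
theorem integral_smul_vecMul_borel_mul (μ' : Measure Fˣ) [IsFiniteMeasureOnCompacts μ'] [μ'.IsMulRightInvariant]
    {Φ : (Fin 2 → F) → ℂ} {F₀ : GL (Fin 2) F → ℂ}
    (hΦ0 : ∀ x : Fin 2 → F, ¬ ((∀ j, valuation F (x j) ≤ 1) ∧ ∃ j, valuation F (x j) = 1) → Φ x = 0)
    (hΦF : ∀ k ∈ glInt 2 F, Φ ((k : Matrix (Fin 2) (Fin 2) F) 1) = F₀ k)
    (hB : ∀ p ∈ glInt 2 F, (p : Matrix (Fin 2) (Fin 2) F) 1 0 = 0 → ∀ k ∈ glInt 2 F, F₀ (p * k) = F₀ k)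
    {g b k : GL (Fin 2) F} (hg : g = b * k) (hb : (b : Matrix (Fin 2) (Fin 2) F) 1 0 = 0) (hk : k ∈ glInt 2 F) (z : ℂ) :
    ∫ a : Fˣ, Φ ((a : F) • ((Pi.single 1 1 : Fin 2 → F) ᵥ* (g : Matrix (Fin 2) (Fin 2) F))) * (((normAbs F (a : F) : ℝ≥0) : ℝ) : ℂ) ^ z ∂μ' =
      (((normAbs F ((b : Matrix (Fin 2) (Fin 2) F) 1 1) : ℝ≥0) : ℝ) : ℂ) ^ (-z) *
        (μ'.real {a : Fˣ | valuation F (a : F) = 1} * F₀ k) := by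
  -- `b₁₁` is a unit of `F`
  have hb11 : (b : Matrix (Fin 2) (Fin 2) F) 1 1 ≠ 0 := by
    intro h0
    have hdet : (b : Matrix (Fin 2) (Fin 2) F).det = 0 := by rw [Matrix.det_fin_two, hb, h0]; ring
    exact (Matrix.GeneralLinearGroup.det_ne_zero b) hdet
  set β : Fˣ := Units.mk0 _ hb11 with hβ
  have hβF : (β : F) = (b : Matrix (Fin 2) (Fin 2) F) 1 1 := rfl
  set G : Fˣ → ℂ := fun a' => Φ ((a' : F) • ((Pi.single 1 1 : Fin 2 → F) ᵥ* (k : Matrix (Fin 2) (Fin 2) F))) *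
    (((normAbs F (a' : F) : ℝ≥0) : ℝ) : ℂ) ^ z with hG
  set C : ℂ := (((normAbs F ((β : F)⁻¹) : ℝ≥0) : ℝ) : ℂ) ^ z with hC
  -- the integrand is `a ↦ G (a β) · C`
  have h1 : ∀ a : Fˣ, Φ ((a : F) • ((Pi.single 1 1 : Fin 2 → F) ᵥ* (g : Matrix (Fin 2) (Fin 2) F))) *
      (((normAbs F (a : F) : ℝ≥0) : ℝ) : ℂ) ^ z = (fun a' : Fˣ => G a' * C) (a * β) := by
    intro a
    have harg : (a : F) • ((Pi.single 1 1 : Fin 2 → F) ᵥ* (g : Matrix (Fin 2) (Fin 2) F)) =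
        ((a * β : Fˣ) : F) • ((Pi.single 1 1 : Fin 2 → F) ᵥ* (k : Matrix (Fin 2) (Fin 2) F)) := by
      rw [hg, single_one_vecMul_borel_mul hb, smul_smul, Units.val_mul, hβF]
    have habs : (((normAbs F (a : F) : ℝ≥0) : ℝ) : ℂ) ^ z =
        (((normAbs F ((a * β : Fˣ) : F) : ℝ≥0) : ℝ) : ℂ) ^ z * C := by
      rw [hC, ← Complex.mul_cpow_ofReal_nonneg (NNReal.coe_nonneg _) (NNReal.coe_nonneg _), ← Complex.ofReal_mul, ← NNReal.coe_mul,
        ← map_mul, Units.val_mul, mul_assoc, mul_inv_cancel₀ (β.ne_zero), mul_one]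
    simp only [hG]
    rw [harg, habs, mul_assoc]
  haveI : BorelSpace Fˣ := Units.borelSpace
  simp_rw [h1]
  have h2 : ∫ a : Fˣ, G (a * β) * C ∂μ' = ∫ a : Fˣ, G a * C ∂μ' := integral_mul_right_eq_self (μ := μ') (fun a' : Fˣ => G a' * C) β
  rw [h2, integral_mul_const]
  simp only [hG]
  rw [(integrable_and_integral_eq_const μ' hΦ0 hΦF hB hk z).2, hC, map_inv₀, NNReal.coe_inv, Complex.ofReal_inv,
    Complex.inv_cpow _ _ ?_, ← Complex.cpow_neg, hβF]
  · ring
  · -- `arg` of a non-negative real is not `π`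
    rw [Complex.arg_ofReal_of_nonneg (NNReal.coe_nonneg _)]
    exact Real.pi_ne_zero.symm

/-- **`f_Φ(·, s) = μ'(𝒪ˣ) • (the flat section through F₀)`**: with `|det g| = |b₀₀| |b₁₁|` for `g = b k`,
`|det g|^s · ∫ Φ(a e₂ g)|a|^{2s} dμ' = μ'(𝒪ˣ) · |b₀₀|^s · |b₁₁|^{−s} · F₀(k)` — the value at `g` of the flat section of `Ind(|·|^s, |·|^{−s})` with
`K`-restriction `F₀`, times the constant `μ'(𝒪ˣ)`. [cite: Bump1997, §3.7] [cite: CogdellAnalyticTheory2004, §2.3] [cite: JacquetLanglands1970, §3] -/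
theorem godementSection_eq_const_mul_flat (μ' : Measure Fˣ) [IsFiniteMeasureOnCompacts μ'] [μ'.IsMulRightInvariant]
    {Φ : (Fin 2 → F) → ℂ} {F₀ : GL (Fin 2) F → ℂ}
    (hΦ0 : ∀ x : Fin 2 → F, ¬ ((∀ j, valuation F (x j) ≤ 1) ∧ ∃ j, valuation F (x j) = 1) → Φ x = 0)
    (hΦF : ∀ k ∈ glInt 2 F, Φ ((k : Matrix (Fin 2) (Fin 2) F) 1) = F₀ k)
    (hB : ∀ p ∈ glInt 2 F, (p : Matrix (Fin 2) (Fin 2) F) 1 0 = 0 → ∀ k ∈ glInt 2 F, F₀ (p * k) = F₀ k)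
    {g b k : GL (Fin 2) F} (hg : g = b * k) (hb : (b : Matrix (Fin 2) (Fin 2) F) 1 0 = 0) (hk : k ∈ glInt 2 F) (s : ℂ) :
    (((normAbs F (g : Matrix (Fin 2) (Fin 2) F).det : ℝ≥0) : ℝ) : ℂ) ^ s *
        ∫ a : Fˣ, Φ ((a : F) • ((Pi.single 1 1 : Fin 2 → F) ᵥ* (g : Matrix (Fin 2) (Fin 2) F))) *
          (((normAbs F (a : F) : ℝ≥0) : ℝ) : ℂ) ^ (2 * s) ∂μ' =
      μ'.real {a : Fˣ | valuation F (a : F) = 1} *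
        ((((normAbs F ((b : Matrix (Fin 2) (Fin 2) F) 0 0) : ℝ≥0) : ℝ) : ℂ) ^ s *
          (((normAbs F ((b : Matrix (Fin 2) (Fin 2) F) 1 1) : ℝ≥0) : ℝ) : ℂ) ^ (-s)) * F₀ k := by
  rw [integral_smul_vecMul_borel_mul μ' hΦ0 hΦF hB hg hb hk (2 * s)]
  -- `|det g| = |b₀₀| · |b₁₁|` (`|det k| = 1`)
  have hdet : normAbs F (g : Matrix (Fin 2) (Fin 2) F).det =
      normAbs F ((b : Matrix (Fin 2) (Fin 2) F) 0 0) * normAbs F ((b : Matrix (Fin 2) (Fin 2) F) 1 1) := by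
    rw [hg, Units.val_mul, Matrix.det_mul, map_mul, DeltaCharBorel.normAbs_eq_one_of_valuation_eq_one (valuation_det_eq_one_of_mem_glInt hk),
      mul_one, Matrix.det_fin_two, hb, mul_zero, sub_zero, map_mul]
  have h0 : (0 : ℝ) ≤ ((normAbs F ((b : Matrix (Fin 2) (Fin 2) F) 0 0) : ℝ≥0) : ℝ) := NNReal.coe_nonneg _
  have h1 : (0 : ℝ) ≤ ((normAbs F ((b : Matrix (Fin 2) (Fin 2) F) 1 1) : ℝ≥0) : ℝ) := NNReal.coe_nonneg _
  have hb11 : (((normAbs F ((b : Matrix (Fin 2) (Fin 2) F) 1 1) : ℝ≥0) : ℝ) : ℂ) ≠ 0 := by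
    have : (b : Matrix (Fin 2) (Fin 2) F) 1 1 ≠ 0 := by
      intro h0'
      have hd : (b : Matrix (Fin 2) (Fin 2) F).det = 0 := by rw [Matrix.det_fin_two, hb, h0']; ring
      exact (Matrix.GeneralLinearGroup.det_ne_zero b) hd
    exact_mod_cast (map_ne_zero (normAbs F)).2 this
  rw [hdet, NNReal.coe_mul, Complex.ofReal_mul, Complex.mul_cpow_ofReal_nonneg h0 h1]
  -- `|b₁₁|^s · |b₁₁|^{−2s} = |b₁₁|^{−s}`
  have hpow : (((normAbs F ((b : Matrix (Fin 2) (Fin 2) F) 1 1) : ℝ≥0) : ℝ) : ℂ) ^ s *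
      (((normAbs F ((b : Matrix (Fin 2) (Fin 2) F) 1 1) : ℝ≥0) : ℝ) : ℂ) ^ (-(2 * s)) =
      (((normAbs F ((b : Matrix (Fin 2) (Fin 2) F) 1 1) : ℝ≥0) : ℝ) : ℂ) ^ (-s) := by
    rw [← Complex.cpow_add _ _ hb11]; congr 1; ring
  calc _ = μ'.real {a : Fˣ | valuation F (a : F) = 1} *
        ((((normAbs F ((b : Matrix (Fin 2) (Fin 2) F) 0 0) : ℝ≥0) : ℝ) : ℂ) ^ s *
          ((((normAbs F ((b : Matrix (Fin 2) (Fin 2) F) 1 1) : ℝ≥0) : ℝ) : ℂ) ^ s *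
            (((normAbs F ((b : Matrix (Fin 2) (Fin 2) F) 1 1) : ℝ≥0) : ℝ) : ℂ) ^ (-(2 * s)))) * F₀ k := by ring
    _ = _ := by rw [hpow]

end Section

end Summit.HodgeConjecture.HodgeConjecture.Cruxes.HLiu418.K2LiuGL2GodementCoefficientFinite

end
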